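import Summits.HubbardSuperconductivity.HubbardSuperconductivity.Theses.FixedNodeShadow
import Summits.HubbardSuperconductivity.HubbardSuperconductivity.Theorems.TwTipContinuation.Negative.TipNormalForm

/-!
# Route `FixedNodeShadow`, support `FnPathAtZero` (item stmt-HubbardSuperconductivity-2109)

`γ = 0` BOOKKEEPING: `FnTarget → HubbardSuperconductivity`. Take `(U, δ)` from `FnTarget`; at
`γ = 0` the node-release family `H + γ • (F − H)` is `H` itself (`(0 : ℂ) • _ = 0`), so the
target's every-ground-state bound reads `a'·L⁴ ≤ Re⟨ψ, Δ_dᴴΔ_d ψ⟩` for every normalised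
`(N_L, 0)`-sector ground state of the pure torus at every even `L ≥ L₁`; the even-side `liminf`
bookkeeping that turns such a uniform floor into the summit's conclusion at `(U, δ)` is the tree's
`summitMatrix_of_everyGSOrder` (`Theorems/TwTipContinuation/Negative/TipNormalForm.lean`).
Scalapino, Phys. Rep. 250 (1995) 329, §2. No analysis, no new definitions. [folklore]
-/

-- the mandated namespace `Summit.<Summit>.<Problem>.Theorems` repeats `HubbardSuperconductivity`
-- (single-problem summit, D-0017), which the `dupNamespace` linter flags on every declaration
set_option linter.dupNamespace false

namespace Summit.HubbardSuperconductivity.HubbardSuperconductivity.Theorems.FixedNodeShadow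

open Matrix Literature.MathematicalPhysics.QuantumLattice
open Summit.HubbardSuperconductivity.TwTipContinuation.Negative (summitMatrix_of_everyGSOrder)

/-- **`FnPathAtZero`** (route `FixedNodeShadow`, item stmt-HubbardSuperconductivity-2109):
`FnTarget → HubbardSuperconductivity`, by instantiating the node-release path at `γ = 0` and the
even-side `liminf` bookkeeping. [cite: Scalapino1995, §2 eq. (2.4)] -/
theorem fnPathAtZero_proof :
    Summit.HubbardSuperconductivity.HubbardSuperconductivity.Theses.FixedNodeShadow.FnPathAtZero := by
  intro hT
  obtain ⟨U, hU, δ, hδ, φ, a', ha', L₁, hL⟩ := hT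
  refine HubbardSuperconductivity_iff.mpr ?_
  unfold Literature.Hubbard.DWaveSuperconductivityHubbard
  refine ⟨U, hU, δ, hδ, ?_⟩
  apply summitMatrix_of_everyGSOrder
  refine ⟨a', ha', L₁, fun L _ hL₁ hEven ψ hψ hGS => ?_⟩
  have h := (hL L hL₁ hEven _ rfl).2 0 (Set.mem_Icc.2 ⟨le_rfl, zero_le_one⟩) _ rfl _ rfl ψ hψ
  apply h
  simpa using hGS

end Summit.HubbardSuperconductivity.HubbardSuperconductivity.Theorems.FixedNodeShadow
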